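import Summits.ResolutionOfSingularities.KangarooAtlas.MizutaniMultiplicity
import Summits.ResolutionOfSingularities.KangarooAtlas.MizutaniInvFormsLevel
import Summits.ResolutionOfSingularities.KangarooAtlas.MizutaniAttainedGeneralForms
import HarnessLib

/-!
# The `k^{1/q}`-rational point `[c_0^{1/q} : ⋯ : c_n^{1/q}]` of a vector `c ∈ k^{n+1}` and its invariant forms

Cell `pub-rosobs`, Mizutani enclosure (seat mizutani-encloser-2, gen 6). AI-written; AI review is weaker than expert
review; NOT a resolution-of-singularities theorem (summit relevance C).

Mizutani 1973 §2 works with T. Oda's pairs `(V, W)` (`W` a `k^q`-vector space, `V ⊂ k ⊗_{k^q} W`, `q = p^e`); the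
H-schemes of exponent `e` «associated with a closed point» of his Example 2.1 / Remark 2.10 / Thm. 2.8 sit over points of
`ℙ^n_k` whose coordinates are `q`-th roots.  In the tree's language (points `𝔭` of `ℙ^n_k`, `invForms k p 𝔭 e = (L_B)_e`,
the tensor dictionary of `MizutaniInvFormsTensor.lean`) these are the `k^{1/q}`-RATIONAL POINTS: for a vector `c ∈ k^{n+1}`,

  `ratPoint k p e c = ker( k[X_0, …, X_n] → k[T], X_i ↦ c_i T, scalars through F^e ) = ` the point `[c_0^{1/q} : ⋯ : c_n^{1/q}]`

(the attained point `GenAtt.attP k p e u` of Mizutani's `H_e`, encloser-1/encloser-2, is `ratPoint k p e (attC u)`: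
`GenAtt.attP_eq_ratPoint`).  This file sets these points up for an ARBITRARY vector `c` (API adapted from
`MizutaniAttainedGeneralPoint.lean`, which treats the special vector `attC u`):

* `ratPsi`, `ratChi`, `ratPoint`; `ratPsi_monomial`, `ratPsi_of_isHomogeneous`, `coeff_ratPsi`, `mem_ratPoint_iff_of_isHomogeneous`
  (`f` homogeneous: `f ∈ ratPoint c ↔ f^{(F^e)}(c) = 0`), `homogeneousComponent_mem_ratPoint`, `ratPoint_isPrime`, `X_mem_ratPoint_iff`,
  **`isPoint_ratPoint`** (`c ≠ 0`);
* **`addForm_mem_ratPoint_iff`** (`Σ g_i X_i^{p^{e+m}} ∈ ratPoint c ↔ Σ g_i c_i^{p^m} = 0`), `addForm_zero_mem_ratPoint_iff` (LINEAR forms: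
  `↔ Σ g_i^{q} c_i = 0`), `mem_invForms_ratPoint_zero_iff`, **`invForms_ratPoint_zero_eq_bot`** (no linear form vanishes at the point when
  the `c_i` are `k^q`-linearly independent — Mizutani's side condition «`V ∩ W = {0}`» of Thm. 2.8);
* `ratBeta`, **`mem_invForms_ratPoint_iff`** — `a ∈ (L_B)_{e+m}(ratPoint c) ↔ Σ_i a_i ⊗ c_i^{p^m} ∈ J^{p^{e+m}}` in `k ⊗_{k^{p^{e+m}}} k`
  (Oda's coefficient-differential-operator definition through Grothendieck duality, `mem_ideal_pow_iff_forall_dPair`), and the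
  level-`e` case `mem_invForms_ratPoint_iff_zero` (`↔ Σ a_i ⊗ c_i ∈ J^q`).

The sequel `MizutaniRationalPointDual.lean` proves that these are exactly the points with `cdim = 1` and the DUALITY
`a ∈ (L_B)_e(ratPoint c) ↔ c ∈ (L_B)_e(ratPoint a)`.

## References

* H. Mizutani, *Hironaka's additive group schemes*, Nagoya Math. J. 52 (1973) 85–95, Example 2.1, Thm. 2.8, Remark 2.10.
  [Mizutani1973HironakaGroupSchemes]
* T. Oda, *Hironaka's additive group scheme, II*, Publ. RIMS 19 (1983), §2 (p. 1168), Lemma 2.1, Thm. 3.1. [Oda1983HironakaGroupSchemeII]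
-/

noncomputable section

open MvPolynomial TensorProduct Literature.AlgebraicGeometry.Resolution
  Literature.AlgebraicGeometry.Resolution.HironakaScheme

namespace Summit.ResolutionOfSingularities.KangarooAtlas.Mizutani

universe u

/-! ## The `k^{1/q}`-rational point of a vector `c ∈ k^{n+1}` -/

section RatPoint

variable (k : Type u) [Field k] (p e : ℕ) [hp : Fact p.Prime] [CharP k p] {n : ℕ} (c : Fin (n + 1) → k)

/-- `ψ_c : k[X_0, …, X_n] → k[T]`, `X_i ↦ c_i T`, scalars through `F^e` (as for `GenAtt.attPsi`).
[cite: Oda1983HironakaGroupSchemeII, §2 (p. 1168: the twist F^e) and Thm. 3.1 (p. 1173: the point attached to φ)] -/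
noncomputable def ratPsi : MvPolynomial (Fin (n + 1)) k →+* Polynomial k :=
  eval₂Hom (Polynomial.C.comp (iterateFrobenius k p e : k →+* k)) (fun i => Polynomial.C (c i) * Polynomial.X)

/-- The same map with `T = 1`: `k[X] → k`, `X_i ↦ c_i`, scalars through `F^e`. [folklore] -/
noncomputable def ratChi : MvPolynomial (Fin (n + 1)) k →+* k :=
  eval₂Hom (iterateFrobenius k p e : k →+* k) c

/-- **The `k^{1/q}`-rational point `[c_0^{1/q} : ⋯ : c_n^{1/q}]` of `ℙ^n_k`** (`q = p^e`): the homogeneous ideal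
`ratPoint k p e c = ker ψ_c` of all `f` with `f^{(F^e)}(c) = 0` degree by degree.
[cite: Mizutani1973HironakaGroupSchemes, Example 2.1 and Remark 2.10 (the points of the schemes H_e); Oda1983HironakaGroupSchemeII, Thm. 3.1] -/
noncomputable def ratPoint : Ideal (MvPolynomial (Fin (n + 1)) k) := RingHom.ker (ratPsi k p e c)

/-- The attained point of Mizutani's `H_e` is the `k^{1/q}`-rational point of the vector `attC u = (u^{W_i})_i`. [cite: Mizutani1973HironakaGroupSchemes, Remark 2.10] -/
theorem GenAtt.attP_eq_ratPoint (u : Fin 2 → k) :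
    GenAtt.attP k p e u = ratPoint k p e (GenAtt.attC k p e u) := rfl

variable {k p e c}

/-- `ψ_c` on a monomial: `a X^m ↦ (F^e a · c^m) T^{|m|}`. [folklore] -/
theorem ratPsi_monomial (m : Fin (n + 1) →₀ ℕ) (a : k) :
    ratPsi k p e c (monomial m a) = Polynomial.monomial m.degree (ratChi k p e c (monomial m a)) := by
  unfold ratPsi ratChi
  rw [eval₂Hom_monomial, eval₂Hom_monomial, RingHom.comp_apply, ← Polynomial.C_mul_X_pow_eq_monomial, map_mul,
    mul_assoc]
  congr 1
  rw [Finsupp.degree_apply, Finsupp.prod, Finsupp.prod, map_prod, ← Finset.prod_pow_eq_pow_sum,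
    ← Finset.prod_mul_distrib]
  refine Finset.prod_congr rfl fun i _ => ?_
  rw [mul_pow, map_pow]

/-- `ψ_c` on a homogeneous polynomial of degree `d` is `χ_c(φ) · T^d`. [folklore] -/
theorem ratPsi_of_isHomogeneous {φ : MvPolynomial (Fin (n + 1)) k} {d : ℕ}
    (hφ : φ.IsHomogeneous d) : ratPsi k p e c φ = Polynomial.monomial d (ratChi k p e c φ) := by
  conv_lhs => rw [φ.as_sum]
  conv_rhs => rw [φ.as_sum]
  rw [map_sum, map_sum, map_sum]
  refine Finset.sum_congr rfl fun m hm => ?_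
  have hmd : m.degree = d := by
    have h := hφ (mem_support_iff.mp hm)
    rw [Finsupp.degree_eq_weight_one]
    exact h
  rw [ratPsi_monomial, hmd]

/-- The `T^d`-coefficient of `ψ_c f` is `χ_c` of the degree-`d` component of `f`. [folklore] -/
theorem coeff_ratPsi (f : MvPolynomial (Fin (n + 1)) k) (d : ℕ) :
    (ratPsi k p e c f).coeff d = ratChi k p e c (homogeneousComponent d f) := by
  classical
  conv_lhs => rw [← sum_homogeneousComponent f, map_sum]
  rw [Polynomial.finsetSum_coeff]
  have hterm : ∀ i ∈ Finset.range (f.totalDegree + 1),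
      (ratPsi k p e c (homogeneousComponent i f)).coeff d =
        if i = d then ratChi k p e c (homogeneousComponent d f) else 0 := by
    intro i _
    rw [ratPsi_of_isHomogeneous (homogeneousComponent_isHomogeneous i f), Polynomial.coeff_monomial]
    by_cases hid : i = d
    · subst hid; simp
    · simp [hid]
  rw [Finset.sum_congr rfl hterm, Finset.sum_ite_eq' (Finset.range (f.totalDegree + 1)) d]
  split_ifs with hd
  · rfl
  · rw [Finset.mem_range, not_lt] at hd
    rw [homogeneousComponent_eq_zero d f (by omega), map_zero]

/-- A homogeneous `f` of degree `d` lies in `ratPoint c` iff `χ_c(f) = f^{(F^e)}(c) = 0`. [folklore] -/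
theorem mem_ratPoint_iff_of_isHomogeneous {f : MvPolynomial (Fin (n + 1)) k} {d : ℕ} (hf : f.IsHomogeneous d) :
    f ∈ ratPoint k p e c ↔ ratChi k p e c f = 0 := by
  unfold ratPoint
  rw [RingHom.mem_ker, ratPsi_of_isHomogeneous hf, Polynomial.monomial_eq_zero_iff]

/-- **`ratPoint c` is homogeneous**: with `f` it contains every homogeneous component of `f`. [cite: Oda1983HironakaGroupSchemeII, §2 (p. 1168: homogeneous primes)] -/
theorem homogeneousComponent_mem_ratPoint {f : MvPolynomial (Fin (n + 1)) k}
    (hf : f ∈ ratPoint k p e c) (d : ℕ) : homogeneousComponent d f ∈ ratPoint k p e c := by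
  unfold ratPoint at hf ⊢
  rw [RingHom.mem_ker] at hf ⊢
  rw [ratPsi_of_isHomogeneous (homogeneousComponent_isHomogeneous d f), ← coeff_ratPsi, hf,
    Polynomial.coeff_zero, map_zero]

/-- `ratPoint c` is a prime ideal. [folklore] -/
theorem ratPoint_isPrime : (ratPoint k p e c).IsPrime := RingHom.ker_isPrime _

/-- `ratPoint c ≠ ⊤`. [folklore] -/
theorem ratPoint_ne_top : ratPoint k p e c ≠ ⊤ := (RingHom.ker_isPrime (ratPsi k p e c)).ne_top

/-- `ψ_c(X_i) = c_i T`. [folklore] -/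
theorem ratPsi_X (i : Fin (n + 1)) : ratPsi k p e c (X i) = Polynomial.C (c i) * Polynomial.X := by
  unfold ratPsi
  rw [eval₂Hom_X']

/-- `X_i ∈ ratPoint c ↔ c_i = 0`. [folklore] -/
theorem X_mem_ratPoint_iff (i : Fin (n + 1)) : (X i : MvPolynomial (Fin (n + 1)) k) ∈ ratPoint k p e c ↔ c i = 0 := by
  unfold ratPoint
  rw [RingHom.mem_ker, ratPsi_X, mul_eq_zero, Polynomial.C_eq_zero]
  exact ⟨fun h => h.resolve_right Polynomial.X_ne_zero, fun h => Or.inl h⟩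

/-- **`ratPoint c` is a point of `ℙ^n`** (a homogeneous prime not containing the irrelevant ideal) as soon as `c ≠ 0`.
[cite: Oda1983HironakaGroupSchemeII, §2 (p. 1168: "a homogeneous prime ideal 𝔭 of S with 𝔭 ≠ S_+")] -/
theorem isPoint_ratPoint (hc : c ≠ 0) : IsPoint k (ratPoint k p e c) := by
  refine ⟨ratPoint_isPrime, fun f hf d => homogeneousComponent_mem_ratPoint hf d, fun hle => ?_⟩
  obtain ⟨i, hi⟩ : ∃ i, c i ≠ 0 := by
    by_contra h
    push Not at h
    exact hc (funext h)
  have hX : (X i : MvPolynomial (Fin (n + 1)) k) ∈ irrelevant k n := by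
    unfold irrelevant; rw [RingHom.mem_ker, constantCoeff_X]
  exact hi ((X_mem_ratPoint_iff i).mp (hle hX))

/-! ### Additive forms through the point -/

/-- `c_i^{p^e · p^m} = F^e (c_i^{p^m})`. [folklore] -/
theorem pow_pow_eq_iterateFrobenius (m : ℕ) (x : k) : x ^ p ^ (e + m) = iterateFrobenius k p e (x ^ p ^ m) := by
  rw [iterateFrobenius_def, ← pow_mul, ← pow_add, add_comm]

/-- **An additive form of level `e + m` lies in `ratPoint c` iff `Σ_i g_i c_i^{p^m} = 0`.**
[cite: Oda1983HironakaGroupSchemeII, Lemma 2.1 (p. 1169: Q = 𝔭 ∩ L)] -/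
theorem addForm_mem_ratPoint_iff (m : ℕ) (g : Fin (n + 1) → k) :
    addForm k p (e + m) g ∈ ratPoint k p e c ↔ ∑ i, g i * c i ^ p ^ m = 0 := by
  unfold ratPoint addForm
  rw [RingHom.mem_ker, map_sum]
  have hterm : ∀ i, ratPsi k p e c (C (g i) * X i ^ p ^ (e + m)) =
      Polynomial.C (iterateFrobenius k p e (g i * c i ^ p ^ m)) * Polynomial.X ^ p ^ (e + m) := by
    intro i
    unfold ratPsi
    rw [map_mul, map_pow, eval₂Hom_C, eval₂Hom_X', RingHom.comp_apply]
    rw [mul_pow, ← map_pow, pow_pow_eq_iterateFrobenius, map_mul, map_mul]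
    ring
  rw [Finset.sum_congr rfl fun i _ => hterm i, ← Finset.sum_mul, ← map_sum, ← map_sum, mul_eq_zero,
    Polynomial.C_eq_zero, map_eq_zero_iff _ (iterateFrobenius k p e).injective]
  constructor
  · rintro (h | h)
    · exact h
    · exact absurd h (pow_ne_zero _ Polynomial.X_ne_zero)
  · intro h; exact Or.inl h

/-- **A LINEAR form `Σ g_i X_i` vanishes at `[c^{1/q}]` iff `Σ_i g_i^q c_i = 0`.** [cite: Mizutani1973HironakaGroupSchemes, Thm. 2.8 (the condition V ∩ W = {0})] -/
theorem addForm_zero_mem_ratPoint_iff (g : Fin (n + 1) → k) :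
    addForm k p 0 g ∈ ratPoint k p e c ↔ ∑ i, g i ^ p ^ e * c i = 0 := by
  unfold ratPoint addForm
  rw [RingHom.mem_ker, map_sum]
  have hterm : ∀ i, ratPsi k p e c (C (g i) * X i ^ p ^ 0) =
      Polynomial.C (g i ^ p ^ e * c i) * Polynomial.X := by
    intro i
    unfold ratPsi
    rw [map_mul, map_pow, eval₂Hom_C, eval₂Hom_X', RingHom.comp_apply, iterateFrobenius_def, pow_zero, pow_one,
      map_mul, mul_assoc]
  rw [Finset.sum_congr rfl fun i _ => hterm i, ← Finset.sum_mul, ← map_sum, mul_eq_zero, Polynomial.C_eq_zero]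
  exact ⟨fun h => h.resolve_right Polynomial.X_ne_zero, fun h => Or.inl h⟩

/-- Level `0` of `(L_B)(ratPoint c)`: `a ∈ (L_B)_0 ↔ Σ_i a_i^q c_i = 0`. [cite: Oda1983HironakaGroupSchemeII, §2 (p. 1168)] -/
theorem mem_invForms_ratPoint_zero_iff (a : Fin (n + 1) → k) :
    a ∈ invForms k p (ratPoint k p e c) 0 ↔ ∑ i, a i ^ p ^ e * c i = 0 := by
  rw [mem_invForms_zero_iff, addForm_zero_mem_ratPoint_iff]

/-- **No linear form vanishes at `[c^{1/q}]` when the `c_i` are `k^q`-linearly independent** — Mizutani's side condition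
«`V ∩ W = {0}`» of Thm. 2.8 for the point `ratPoint c`. [cite: Mizutani1973HironakaGroupSchemes, Thm. 2.8 and (*) (iv)] -/
theorem invForms_ratPoint_zero_eq_bot (hc : LinearIndependent (frobPow k p e) c) :
    invForms k p (ratPoint k p e c) 0 = ⊥ := by
  rw [Submodule.eq_bot_iff]
  intro a ha
  rw [mem_invForms_ratPoint_zero_iff] at ha
  have h : ∑ i, (⟨a i ^ p ^ e, ⟨a i, rfl⟩⟩ : frobPow k p e) • c i = 0 := by
    rw [← ha]
    exact Finset.sum_congr rfl fun i _ => rfl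
  have h0 := Fintype.linearIndependent_iff.mp hc _ h
  funext i
  have hi := congrArg Subtype.val (h0 i)
  exact eq_zero_of_pow_eq_zero (hi : a i ^ p ^ e = 0)

/-! ### The invariant forms as tensors -/

variable (k p e c) in
/-- `β_m(a) = Σ_i a_i ⊗ c_i^{p^m} ∈ k ⊗_{k^{p^{e+m}}} k` (as `GenAtt.attBeta`, for an arbitrary vector `c`).
[cite: Oda1983HironakaGroupSchemeII, Thm. 3.1 (p. 1173: (1 ⊗ φ)(v)); Mizutani1973HironakaGroupSchemes, §2 (V ⊂ k ⊗_{k^q} W)] -/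
noncomputable def ratBeta (m : ℕ) (a : Fin (n + 1) → k) : k ⊗[frobPow k p (e + m)] k :=
  ∑ i, a i ⊗ₜ[frobPow k p (e + m)] (c i ^ p ^ m)

/-- **`a ∈ (L_B)_{e+m}(ratPoint c) ⟺ Σ_i a_i ⊗ c_i^{p^m} ∈ J^{p^{e+m}}`**: Oda's coefficient-differential-operator definition of
the invariant additive forms, read in the tensor square through Grothendieck duality (`mem_ideal_pow_iff_forall_dPair`).
[cite: Oda1983HironakaGroupSchemeII, §2 (p. 1168) and Cor. 2.3 (p. 1171)] -/
theorem mem_invForms_ratPoint_iff (m : ℕ) (a : Fin (n + 1) → k) :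
    a ∈ invForms k p (ratPoint k p e c) (e + m) ↔
      ratBeta k p e c m a ∈ KaehlerDifferential.ideal (frobPow k p (e + m)) k ^ p ^ (e + m) := by
  have hq : p ^ (e + m) = (p ^ (e + m) - 1) + 1 := (Nat.sub_add_cancel (Nat.one_le_pow _ _ hp.out.pos)).symm
  have hpair : ∀ D : k →ₗ[frobPow k p (e + m)] k,
      dPair (frobPow k p (e + m)) (AlgHom.id _ _) D (ratBeta k p e c m a) = ∑ i, D (a i) * c i ^ p ^ m := by
    intro D
    unfold ratBeta
    rw [map_sum]
    exact Finset.sum_congr rfl fun i _ => by rw [dPair_tmul, AlgHom.id_apply]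
  have key := mem_ideal_pow_iff_forall_dPair (frobPow k p (e + m)) (p ^ (e + m) - 1) (ratBeta k p e c m a)
  rw [← hq] at key
  rw [key]
  constructor
  · intro ha D hD
    rw [hpair, ← addForm_mem_ratPoint_iff]
    exact ha D hD
  · intro h D hD
    show addForm k p (e + m) (fun j => D (a j)) ∈ ratPoint k p e c
    rw [addForm_mem_ratPoint_iff, ← hpair]
    exact h D hD

/-- The level-`e` case: **`a ∈ (L_B)_e(ratPoint c) ⟺ Σ_i a_i ⊗ c_i ∈ J^q`** in `k ⊗_{k^q} k`. [cite: Oda1983HironakaGroupSchemeII, §2 (p. 1168) and Cor. 2.3] -/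
theorem mem_invForms_ratPoint_iff_zero (a : Fin (n + 1) → k) :
    a ∈ invForms k p (ratPoint k p e c) e ↔
      (∑ i, a i ⊗ₜ[frobPow k p e] c i) ∈ KaehlerDifferential.ideal (frobPow k p e) k ^ p ^ e := by
  have h := mem_invForms_ratPoint_iff (e := e) (c := c) 0 a
  simp only [Nat.add_zero, ratBeta, pow_zero, pow_one] at h
  exact h

end RatPoint

end Summit.ResolutionOfSingularities.KangarooAtlas.Mizutani

end
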